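import Mathlib.Analysis.SpecialFunctions.Log.Basic
import Mathlib.Analysis.SpecificLimits.Basic
import Mathlib.Topology.Order.Real
import Literature.Computability.Complexity.CNF
import Literature.Computability.MetaComplexity.Resolution
import Literature.Computability.MetaComplexity.FpLinearSystems
import Literature.Computability.MetaComplexity.FpLinearSystemsProofs
import Literature.Computability.MetaComplexity.StrongResolutionWidth
import Literature.Computability.MetaComplexity.ExpanderWidthLowerBound
import HarnessLib

/-!
# Discharge of `strongResWidth_kCNF`: `k`-CNFs of near-maximal resolution width exist
(Bonacina 2017, Thm 8.1; Beck 2017, Thm 5.7; Beck–Impagliazzo 2013)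

Sibling proof file of `StrongResolutionWidth.lean` (D-0014). It proves
`Literature.CplxMeta.strongResWidth_kCNF_holds : strongResWidth_kCNF`: the named width fact
(`StrongResolutionWidth.lean`; Bonacina 2017 Thm 8.1 = [BT16a]; Beck–Impagliazzo 2013 with the
weaker rate) is DERIVED from the named fact `fpExpandingSystem` (`FpLinearSystems.lean`;
Bonacina 2017 Prop. 8.1 = Beck–Impagliazzo 2013 Lemma 4.2 = Beck 2017 Lemma 5.2), which is
itself proved in `FpLinearSystemsProofs.lean` (`fpExpandingSystem_holds`). The bridge is the
deterministic width theorem `width_lower_bound_of_expander` (`ExpanderWidthLowerBound.lean`,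
Beck 2017 Thm 5.7 / Bonacina 2017 proof of Thm 8.1: semantic measure, medium-complexity
clause, free blocks, dual witnesses, minimality, averaging over `𝔽_p`) applied to the landed
sum-encoding `sumEncoding` with `u = p²` bits per unknown (clause width `≤ p⁴`), followed by
padding to arbitrarily many variables and a diagonalisation of the accuracies
(`exists_seq_tendsto_zero_eventually`). Only the qualitative rate `ζ_k → 0` of the fact is
needed (and obtained); the source's `Õ(k^{-1/3})` (Bonacina) resp. `Õ(k^{-1/4})`
(Beck–Impagliazzo) rates are not claimed.

## Proof of `strongResWidth_fixed` (Bonacina 2017, proof of Thm 8.1, last lines p. 128; Beck 2017 Thm 5.7)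

Given `ζ > 0`: `fpExpandingSystem` holds for all large primes `p` with `θ ≤ C (log p)^c / p`,
which is `< ζ/3` for large `p` (`(log p)^c / p → 0`); fix such a prime `p ≥ max(3, ⌈6/ζ⌉)` and
the `δ > 0` and systems `E_n` (`n ≥ n₀`) it provides. Put `u = p²`. For `k ≥ p² u` and
`N ≥ u · max(n₀, p, ⌈2/(3δ)⌉, ⌈2/ζ⌉)`, `n := ⌊N/u⌋`, the CNF `sumEncoding u E_n` is a `k`-CNF
on `≤ n u ≤ N` variables, unsatisfiable (`sumEncoding_satisfiable_iff`), and by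
`width_lower_bound_of_expander` (with `canonicalBitEncoding`) every refutation has width
`≥ (1 - ζ/3) n (u - p + 1) ≥ (1 - ζ/3)(1 - 1/p) n u ≥ (1 - ζ) (n+1) u > (1 - ζ) N`
(using `1/p ≤ ζ/6` and `n ≥ 2/ζ`). Then diagonalise over `ζ ↓ 0`
(`exists_seq_tendsto_zero_eventually`).

## References

* I. Bonacina, *Space in Weak Propositional Proof Systems*, Springer 2017, Thm 8.1, Prop. 8.1,
  §8.3 (proof of Thm 8.1, pp. 124–128).
* C. Beck, *Time and Space in Proof Complexity*, PhD thesis, Princeton 2017, Lemma 5.2,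
  Thm 5.7.
* C. Beck, R. Impagliazzo, *Strong ETH holds for regular resolution*, STOC 2013, 487–494,
  Lemma 4.2 and the width theorem.
* I. Bonacina, N. Talebanfard, *Improving resolution width lower bounds for k-CNFs with
  applications to the Strong Exponential Time Hypothesis*, Inf. Process. Lett. 116 (2016).
-/

namespace Literature.Computability.MetaComplexity

open Finset Filter Topology Complexity

/-- The width statement for a fixed accuracy from `fpExpandingSystem`: for every `ζ > 0`, all
large `k` and all large `N`, unsatisfiable `k`-CNFs on `≤ N` variables all of whose refutations
have width `≥ (1 - ζ) N` (Bonacina 2017, Thm 8.1 from Prop. 8.1 via the sum encoding with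
`u = p²` bits, clause width `p⁴`; padding to arbitrary `N`).
[Bonacina 2017, Thm 8.1; Beck 2017 (thesis), Thm 5.7] [cite: Bonacina2017, Thm 8.1]
[cite: Beck2017, Thm 5.7] -/
theorem strongResWidth_fixed (hP : fpExpandingSystem) {ζ : ℝ} (hζ : 0 < ζ) :
    ∀ᶠ k : ℕ in atTop, ∀ᶠ N : ℕ in atTop, ∃ F : CNF ℕ,
      F.IsWidthLE k ∧ F.numVars ≤ N ∧ ¬ F.Satisfiable ∧
      ∀ π : List (ResLine ℕ), IsResRefutation F π → (1 - ζ) * (N : ℝ) ≤ (resWidth π : ℝ) := by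
  classical
  obtain ⟨C, c, hev⟩ := hP
  -- `C (log p)^c / p → 0`
  have hlim : Tendsto (fun p : ℕ => C * (Real.log p ^ c / p)) atTop (𝓝 0) := by
    have h1 : Tendsto (fun x : ℝ => Real.log x ^ c / x) atTop (𝓝 0) := by
      simpa using Real.tendsto_pow_log_div_mul_add_atTop 1 0 c one_ne_zero
    simpa using (h1.comp tendsto_natCast_atTop_atTop).const_mul C
  have hζ3 : 0 < ζ / 3 := by positivity
  obtain ⟨p₁, hp₁⟩ := eventually_atTop.1 ((hev.and (hlim.eventually_lt_const hζ3)).and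
    (eventually_ge_atTop (max 3 ⌈6 / ζ⌉₊)))
  -- a prime `p ≥ p₁`
  obtain ⟨p, hpge, hprime⟩ := Nat.exists_infinite_primes p₁
  obtain ⟨⟨hPp, hθp⟩, hp3ζ⟩ := hp₁ p hpge
  have hp3 : 3 ≤ p := le_trans (le_max_left _ _) hp3ζ
  have hpζ : (6 / ζ : ℝ) ≤ p := le_trans (Nat.le_ceil _) (by exact_mod_cast le_trans (le_max_right _ _) hp3ζ)
  haveI : Fact p.Prime := ⟨hprime⟩
  obtain ⟨δ, θ, hδ, -, -, hθ, hn⟩ := hPp hprime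
  have hθζ : θ ≤ ζ / 3 := by
    have : C * (Real.log p ^ c / p) < ζ / 3 := hθp
    rw [mul_div_assoc] at hθ
    linarith
  obtain ⟨n₀, hn₀⟩ := eventually_atTop.1 hn
  choose! Esys hEsupp hEunsat hEsmall hEexp using hn₀
  set u : ℕ := p ^ 2 with hu
  have hpu : p ≤ u := by rw [hu, pow_two]; exact Nat.le_mul_of_pos_right p hprime.pos
  have hpR : (3 : ℝ) ≤ p := by exact_mod_cast hp3
  have hpR0 : (0 : ℝ) < p := by linarith
  have huR : (u : ℝ) = (p : ℝ) ^ 2 := by rw [hu]; push_cast; ring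
  have hupos : (0 : ℝ) < u := by rw [huR]; positivity
  have huposN : 0 < u := by exact_mod_cast hupos
  have hup : ((u - p + 1 : ℕ) : ℝ) ≥ (u : ℝ) * (1 - 1 / p) := by
    have : ((u - p + 1 : ℕ) : ℝ) = (u : ℝ) - p + 1 := by
      rw [Nat.cast_add, Nat.cast_sub hpu]; push_cast; ring
    rw [this, huR]
    field_simp
    nlinarith
  refine eventually_atTop.2 ⟨p ^ 2 * u, fun k hk => ?_⟩
  refine eventually_atTop.2 ⟨u * max n₀ (max p (max ⌈2 / (3 * δ)⌉₊ ⌈2 / ζ⌉₊)), fun N hN => ?_⟩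
  set n : ℕ := N / u with hn_def
  have hnmax : max n₀ (max p (max ⌈2 / (3 * δ)⌉₊ ⌈2 / ζ⌉₊)) ≤ n :=
    (Nat.le_div_iff_mul_le huposN).2 (by rw [mul_comm]; exact hN)
  have hn₀n : n₀ ≤ n := le_trans (le_max_left _ _) hnmax
  have hpn : p ≤ n := le_trans (le_trans (le_max_left _ _) (le_max_right _ _)) hnmax
  have hδn : (2 / (3 * δ) : ℝ) ≤ n := le_trans (Nat.le_ceil _) (by
    exact_mod_cast le_trans (le_trans (le_trans (le_max_left _ _) (le_max_right _ _)) (le_max_right _ _)) hnmax)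
  have hζn : (2 / ζ : ℝ) ≤ n := le_trans (Nat.le_ceil _) (by
    exact_mod_cast le_trans (le_trans (le_trans (le_max_right _ _) (le_max_right _ _)) (le_max_right _ _)) hnmax)
  have hnR : (3 : ℝ) ≤ n := le_trans hpR (by exact_mod_cast hpn)
  set E := Esys n with hE
  have hsuppN : ∀ i, (E i).supp.card ≤ p ^ 2 := fun i => by
    have := hEsupp n hn₀n i
    exact_mod_cast this
  refine ⟨sumEncoding u E, (isWidthLE_sumEncoding u E hsuppN).mono hk, ?_, ?_, fun π hπ => ?_⟩
  · exact (numVars_sumEncoding_le u E).trans (by rw [hn_def, mul_comm]; exact Nat.div_mul_le_self N u |>.trans' (le_of_eq (mul_comm _ _)))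
  · rw [sumEncoding_satisfiable_iff (Nat.le_succ_of_le hpu) huposN]
    exact hEunsat n hn₀n
  · have h3δn : 2 ≤ 3 * δ * n := by
      rw [div_le_iff₀ (by positivity)] at hδn; linarith
    have hexp' : ∀ v : Fin (n + 1) → ZMod p, δ * n ≤ (vsupp v).card → ((vsupp v).card : ℝ) ≤ 3 * δ * n →
        (1 - ζ / 3) * n ≤ ((lincomb v E).supp.card : ℝ) := by
      intro v h1 h2
      have := hEexp n hn₀n v h1 h2
      have hn0 : (0 : ℝ) ≤ n := by linarith
      nlinarith
    have hw := width_lower_bound_of_expander hp3 hpu (canonicalBitEncoding p u E) (hEunsat n hn₀n) hδ.le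
      (hEsmall n hn₀n) hexp' h3δn
      (fun D hD => (canonicalBitEncoding p u E).exists_of_mem_cnf (by rw [canonicalBitEncoding_cnf]; exact hD)) hπ
    -- `(1-ζ) N ≤ (1 - ζ/3) n (u - p + 1)`
    have hNlt : (N : ℝ) < (n + 1) * u := by
      have := Nat.lt_div_mul_add (a := N) (b := u) huposN
      rw [← hn_def] at this
      have : (N : ℝ) < n * u + u := by exact_mod_cast this
      linarith
    rcases le_or_gt 1 ζ with hζ1 | hζ1
    · have : (1 - ζ) * (N : ℝ) ≤ 0 := mul_nonpos_of_nonpos_of_nonneg (by linarith) (by positivity)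
      have : (0 : ℝ) ≤ resWidth π := by positivity
      linarith
    have h1p : 1 / (p : ℝ) ≤ ζ / 6 := by
      rw [div_le_iff₀ hζ] at hpζ
      rw [div_le_div_iff₀ hpR0 (by norm_num)]
      linarith
    have hζn' : 1 ≤ ζ / 2 * n := by
      rw [div_le_iff₀ hζ] at hζn; linarith
    calc (1 - ζ) * (N : ℝ) ≤ (1 - ζ) * ((n + 1) * u) := by
          apply mul_le_mul_of_nonneg_left hNlt.le; linarith
      _ ≤ (1 - ζ / 3 - 1 / p) * n * u := by
          have hu0 := hupos.le
          have hn0 : (0:ℝ) ≤ n := by linarith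
          nlinarith [mul_nonneg hn0 hu0, mul_le_mul_of_nonneg_right h1p (mul_nonneg hn0 hu0)]
      _ ≤ (1 - ζ / 3) * n * (u * (1 - 1 / p)) := by
          have hn0 : (0:ℝ) ≤ n := by linarith
          have : (1 - ζ / 3 - 1 / p) * (u : ℝ) ≤ (1 - ζ / 3) * (u * (1 - 1 / p)) := by
            have h0 : 0 ≤ (u : ℝ) * (ζ / 3) * (1 / p) := by positivity
            nlinarith
          nlinarith
      _ ≤ (1 - ζ / 3) * n * ((u - p + 1 : ℕ) : ℝ) := by
          apply mul_le_mul_of_nonneg_left hup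
          have : (0:ℝ) ≤ n := by linarith
          have : 0 ≤ 1 - ζ / 3 := by linarith
          positivity
      _ ≤ resWidth π := hw

/-- **`strongResWidth_kCNF` from `fpExpandingSystem`** (Bonacina 2017: Thm 8.1 from Prop. 8.1;
Beck 2017 Thm 5.7 with Lemma 5.2): the named width fact follows from the named expanding-system
fact alone. [Bonacina 2017, Thm 8.1] [cite: Bonacina2017, Thm 8.1] -/
theorem strongResWidth_kCNF_of_fpExpandingSystem (hP : fpExpandingSystem) : strongResWidth_kCNF := by
  obtain ⟨ζs, hζs, hev⟩ := exists_seq_tendsto_zero_eventually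
    (P := fun ζ k => ∀ᶠ N : ℕ in atTop, ∃ F : CNF ℕ, F.IsWidthLE k ∧ F.numVars ≤ N ∧ ¬ F.Satisfiable ∧
      ∀ π : List (ResLine ℕ), IsResRefutation F π → (1 - ζ) * (N : ℝ) ≤ (resWidth π : ℝ))
    (fun ζ hζ => strongResWidth_fixed hP hζ)
  exact ⟨ζs, hζs, hev⟩

/-- **Discharge of the named fact `strongResWidth_kCNF`** (Bonacina 2017, Thm 8.1;
Beck–Impagliazzo 2013): unsatisfiable `k`-CNFs all of whose resolution refutations have width
`≥ (1 - ζ_k) n`, `ζ_k → 0`, exist — from `fpExpandingSystem_holds` (Bonacina 2017 Prop. 8.1,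
proved in `FpLinearSystemsProofs.lean`) and `strongResWidth_kCNF_of_fpExpandingSystem`.
Users holding `(h : strongResWidth_kCNF)` are fed this theorem.
[Bonacina 2017, Thm 8.1] [cite: Bonacina2017, Thm 8.1] -/
theorem strongResWidth_kCNF_holds : strongResWidth_kCNF :=
  strongResWidth_kCNF_of_fpExpandingSystem fpExpandingSystem_holds

end Literature.Computability.MetaComplexity
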